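import Summits.Ventures.QEC.CircuitDistance.PortNormalise
import HarnessLib

/-!
# P3-PORT (C3): the WINDOW LEMMA (T3, δ = 1): `HasAt S Nc w → HasAt S (min Nc w) w` (cell `qec`, experiment CDX, seat
# qec-cdx-type-1)

Proof (crit-1 CARD23-AUDIT §(iii) W1–W3 with the δ-correction realised by normalisation, `PortNormalise`): take a
minimum-`faultCount` NORMAL undetectable logical set of the `Nc`-circuit; by the GAP lemma its cycles form an interval of
length `≤ faultCount ≤ w` (else split at a fault-free cycle: both halves undetectable, one logical, fewer operations); SHIFT it
to start at cycle 1 (`shiftBack`, `shift_normal`: columns move rigidly, `detZ_shift`); TRUNCATE to `w` cycles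
(`transfer_normal`).  Consequences: `hasAt_iff_min` (crit-1's `min Nc (w+1)` form), **`hasLogicalFault_iff_at`**
(`HasLogicalFaultOfWeightAtMost S w ↔ HasAt S w w`: the single circuit size `N₀ = w` decides the `∃ Nc` question) and
`not_hasAt_of_not_hasAt_self`.  Generic in `S`; nothing here asserts a value of `d_circ`.
-/

namespace Summit.Ventures.QEC.CircuitDistance

open Literature.InformationTheory.QuantumCodes

variable {ℓ m : ℕ} [NeZero ℓ] [NeZero m]

/-! ## Shift in time -/

omit [NeZero ℓ] [NeZero m] in
/-- The cycle of an operation. -/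
def Loc.cyc : Loc ℓ m → ℕ
  | .cnot c _ _ => c | .idle c _ _ => c | .initX c _ => c | .initZ c _ => c | .measX c _ => c | .measZ c _ => c

omit [NeZero ℓ] [NeZero m] in
/-- The same operation moved to cycle `c'`. -/
def Loc.retag (c' : ℕ) : Loc ℓ m → Loc ℓ m
  | .cnot _ lay i => .cnot c' lay i | .idle _ s i => .idle c' s i | .initX _ i => .initX c' i
  | .initZ _ i => .initZ c' i | .measX _ i => .measX c' i | .measZ _ i => .measZ c' i

omit [NeZero ℓ] [NeZero m] in
/-- The cycle of a fault is the cycle of its operation. -/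
theorem Fault.cyc_eq_loc_cyc (f : Fault ℓ m) : f.cyc = f.loc.cyc := by cases f <;> rfl

omit [NeZero ℓ] [NeZero m] in
/-- Retagging a fault retags its operation. -/
theorem Fault.loc_retag (f : Fault ℓ m) (c' : ℕ) : (f.retag c').loc = f.loc.retag c' := by cases f <;> rfl

omit [NeZero ℓ] [NeZero m] in
/-- Retagging twice. -/
theorem Fault.retag_retag (f : Fault ℓ m) (a b : ℕ) : (f.retag a).retag b = f.retag b := by cases f <;> rfl

omit [NeZero ℓ] [NeZero m] in
/-- Retagging to the own cycle. -/
theorem Fault.retag_self (f : Fault ℓ m) : f.retag f.cyc = f := by cases f <;> rfl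

omit [NeZero ℓ] [NeZero m] in
/-- Retagging keeps the `InitZ` flag. -/
theorem Fault.isInitZ_retag (f : Fault ℓ m) (c' : ℕ) : (f.retag c').isInitZ = f.isInitZ := by cases f <;> rfl

omit [NeZero ℓ] [NeZero m] in
/-- The time shift by `d` cycles towards the start. -/
def shiftBack (d : ℕ) (f : Fault ℓ m) : Fault ℓ m := f.retag (f.cyc - d)

/-- Shifting a normal fault shifts its `Z`-column. -/
theorem detZ_shift (S : SMCode ℓ m) (Nc d : ℕ) (f : Fault ℓ m) (hf : f.isInitZ = false) (h₁ : d + 1 ≤ f.cyc)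
    (h₂ : f.cyc ≤ Nc) (t : ℕ) (j : BB.Mono ℓ m) : detZ S Nc {shiftBack d f} t j = detZ S Nc {f} (t + d) j := by
  have hc' : (shiftBack d f).cyc = f.cyc - d := Fault.cyc_retag _ _
  have hI' : (shiftBack d f).isInitZ = false := by unfold shiftBack; rw [Fault.isInitZ_retag]; exact hf
  rw [detZ_singleton S Nc (shiftBack d f) (by rw [hc']; omega) (by rw [hc']; omega), detZ_singleton S Nc f (by omega) h₂,
    ancZx_of_not_initZ S _ hI', ancZx_of_not_initZ S f hf, hc']
  unfold shiftBack
  rw [shape_retag]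
  dsimp only
  rw [if_pos rfl]
  simp only [Bool.and_false, Bool.xor_false]
  generalize (shape S f).mZ f.cyc j = μ
  generalize synZ S (shape S f).frame.dataXb j = σ
  by_cases h0 : t + d = f.cyc
  · rw [decide_eq_true h0, decide_eq_true (show t = f.cyc - d by omega), decide_eq_false (show ¬ t + d = f.cyc + 1 by omega),
      decide_eq_false (show ¬ t = f.cyc - d + 1 by omega)]
  · rw [decide_eq_false h0, decide_eq_false (show ¬ t = f.cyc - d by omega)]
    by_cases h1 : t + d = f.cyc + 1
    · rw [decide_eq_true h1, decide_eq_true (show t = f.cyc - d + 1 by omega)]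
    · rw [decide_eq_false h1, decide_eq_false (show ¬ t = f.cyc - d + 1 by omega)]

/-- Shifting a normal fault shifts its `X`-column. -/
theorem detX_shift (S : SMCode ℓ m) (Nc d : ℕ) (f : Fault ℓ m) (h₁ : d + 1 ≤ f.cyc) (h₂ : f.cyc ≤ Nc) (t : ℕ)
    (i : BB.Mono ℓ m) : detX S Nc {shiftBack d f} t i = detX S Nc {f} (t + d) i := by
  have hc' : (shiftBack d f).cyc = f.cyc - d := Fault.cyc_retag _ _
  rw [detX_singleton S Nc (shiftBack d f) (by rw [hc']; omega) (by rw [hc']; omega), detX_singleton S Nc f (by omega) h₂, hc']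
  unfold shiftBack
  rw [shape_retag]
  dsimp only
  rw [if_pos rfl]
  generalize (shape S f).mX f.cyc i = μ
  generalize synX S (shape S f).frame.dataZb i = σ
  by_cases h0 : t + d = f.cyc
  · rw [decide_eq_true h0, decide_eq_true (show t = f.cyc - d by omega), decide_eq_false (show ¬ t + d = f.cyc + 1 by omega),
      decide_eq_false (show ¬ t = f.cyc - d + 1 by omega)]
  · rw [decide_eq_false h0, decide_eq_false (show ¬ t = f.cyc - d by omega)]
    by_cases h1 : t + d = f.cyc + 1
    · rw [decide_eq_true h1, decide_eq_true (show t = f.cyc - d + 1 by omega)]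
    · rw [decide_eq_false h1, decide_eq_false (show ¬ t = f.cyc - d + 1 by omega)]

/-- Shifting keeps the residual `X`-error. -/
theorem dataX_shift (S : SMCode ℓ m) (Nc d : ℕ) (f : Fault ℓ m) (h₁ : d + 1 ≤ f.cyc) (h₂ : f.cyc ≤ Nc) :
    dataX S Nc {shiftBack d f} = dataX S Nc {f} := by
  have hc' : (shiftBack d f).cyc = f.cyc - d := Fault.cyc_retag _ _
  rw [dataX_singleton S Nc (shiftBack d f) (by rw [hc']; omega) (by rw [hc']; omega), dataX_singleton S Nc f (by omega) h₂]
  unfold shiftBack; rw [shape_retag]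

/-- Shifting keeps the residual `Z`-error. -/
theorem dataZ_shift (S : SMCode ℓ m) (Nc d : ℕ) (f : Fault ℓ m) (h₁ : d + 1 ≤ f.cyc) (h₂ : f.cyc ≤ Nc) :
    dataZ S Nc {shiftBack d f} = dataZ S Nc {f} := by
  have hc' : (shiftBack d f).cyc = f.cyc - d := Fault.cyc_retag _ _
  rw [dataZ_singleton S Nc (shiftBack d f) (by rw [hc']; omega) (by rw [hc']; omega), dataZ_singleton S Nc f (by omega) h₂]
  unfold shiftBack; rw [shape_retag]

omit [NeZero ℓ] [NeZero m] in
/-- The shift is injective on faults of cycle `≥ d`. -/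
theorem shiftBack_injOn (d : ℕ) (F : Finset (Fault ℓ m)) (hd : ∀ f ∈ F, d + 1 ≤ f.cyc) :
    Set.InjOn (shiftBack (ℓ := ℓ) (m := m) d) F := by
  intro f hf g hg hfg
  have hc : f.cyc - d = g.cyc - d := by
    have := congrArg Fault.cyc hfg; simp only [shiftBack, Fault.cyc_retag] at this; exact this
  have hc' : f.cyc = g.cyc := by have := hd f hf; have := hd g hg; omega
  have : (shiftBack d f).retag f.cyc = (shiftBack d g).retag f.cyc := by rw [hfg]
  unfold shiftBack at this
  rw [Fault.retag_retag, Fault.retag_retag, Fault.retag_self, hc', Fault.retag_self] at this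
  exact this

omit [NeZero ℓ] [NeZero m] in
/-- Parity sums over an injective image. -/
theorem bsum_image_of_injOn {φ : Fault ℓ m → Fault ℓ m} {F : Finset (Fault ℓ m)} (hφ : Set.InjOn φ F)
    (g : Fault ℓ m → Bool) : bsum (F.image φ) g = bsum F (g ∘ φ) := by
  classical
  unfold bsum
  rw [Finset.filter_image, Finset.card_image_of_injOn (fun a ha b hb h => hφ (Finset.mem_filter.1 ha).1 (Finset.mem_filter.1 hb).1 h)]
  rfl

/-- **SHIFT LEMMA.** Translating a normal set back in time by `d` cycles (all cycles stay `≥ 1`) preserves normality,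
undetectability, the residuals (hence the logical error) and does not increase the number of faulty operations; all cycles
drop by `d`. -/
theorem shift_normal (S : SMCode ℓ m) (Nc d : ℕ) (F : Finset (Fault ℓ m)) (hN : Normal Nc F) (hd : ∀ f ∈ F, d + 1 ≤ f.cyc)
    (hU : Undetectable S Nc F) (hL : LogicalError S Nc F) :
    Normal Nc (F.image (shiftBack d)) ∧ Undetectable S Nc (F.image (shiftBack d)) ∧ LogicalError S Nc (F.image (shiftBack d)) ∧
      faultCount (F.image (shiftBack d)) ≤ faultCount F ∧ ∀ f' ∈ F.image (shiftBack d), f'.cyc + d ≤ Nc := by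
  classical
  have hinj := shiftBack_injOn d F hd
  have hN' : Normal Nc (F.image (shiftBack d)) := by
    intro f' hf'
    obtain ⟨f, hf, rfl⟩ := Finset.mem_image.1 hf'
    refine ⟨?_, ?_, ?_⟩
    · show 1 ≤ (f.retag _).cyc; rw [Fault.cyc_retag]; have := hd f hf; omega
    · show (f.retag _).cyc ≤ Nc; rw [Fault.cyc_retag]; have := (hN f hf).2.1; omega
    · show (f.retag _).isInitZ = false; rw [Fault.isInitZ_retag]; exact (hN f hf).2.2
  have hZ : ∀ t j, detZ S Nc (F.image (shiftBack d)) t j = detZ S Nc F (t + d) j := by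
    intro t j
    rw [detZ_eq_bsum, bsum_image_of_injOn hinj, detZ_eq_bsum S Nc F]
    exact bsum_congr fun f hf => detZ_shift S Nc d f (hN f hf).2.2 (hd f hf) (hN f hf).2.1 t j
  have hX : ∀ t i, detX S Nc (F.image (shiftBack d)) t i = detX S Nc F (t + d) i := by
    intro t i
    rw [detX_eq_bsum, bsum_image_of_injOn hinj, detX_eq_bsum S Nc F]
    exact bsum_congr fun f hf => detX_shift S Nc d f (hd f hf) (hN f hf).2.1 t i
  have hdX : dataX S Nc (F.image (shiftBack d)) = dataX S Nc F := by
    rw [dataX_eq_sum, Finset.sum_image hinj, dataX_eq_sum S Nc F]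
    exact Finset.sum_congr rfl fun f hf => dataX_shift S Nc d f (hd f hf) (hN f hf).2.1
  have hdZ : dataZ S Nc (F.image (shiftBack d)) = dataZ S Nc F := by
    rw [dataZ_eq_sum, Finset.sum_image hinj, dataZ_eq_sum S Nc F]
    exact Finset.sum_congr rfl fun f hf => dataZ_shift S Nc d f (hd f hf) (hN f hf).2.1
  refine ⟨hN', ⟨fun f' hf' => ?_, fun t i => ⟨?_, ?_⟩⟩, ?_, ?_, fun f' hf' => ?_⟩
  · rw [mem_allEvents_iff, Fault.ev_cyc]; exact ⟨(hN' f' hf').1, (hN' f' hf').2.1⟩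
  · rw [hX]; exact (hU.2 _ i).1
  · rw [hZ]; exact (hU.2 _ i).2
  · unfold LogicalError at hL ⊢; rw [hdX, hdZ]; exact hL
  · -- faultCount: locations move along `Loc.retag`
    unfold faultCount
    have : (F.image (shiftBack d)).image Fault.loc = (F.image Fault.loc).image fun L => L.retag (L.cyc - d) := by
      rw [Finset.image_image, Finset.image_image]
      apply Finset.image_congr
      intro f _
      show (f.retag (f.cyc - d)).loc = f.loc.retag (f.loc.cyc - d)
      rw [Fault.loc_retag, Fault.cyc_eq_loc_cyc]
    rw [this]; exact Finset.card_image_le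
  · obtain ⟨f, hf, rfl⟩ := Finset.mem_image.1 hf'
    show (f.retag _).cyc + d ≤ Nc
    rw [Fault.cyc_retag]; have := (hN f hf).2.1; have := hd f hf; omega

/-! ## The window -/

/-- An undetectable LOGICAL fault set is non-empty. -/
theorem nonempty_of_logicalError (S : SMCode ℓ m) (Nc : ℕ) (F : Finset (Fault ℓ m)) (hL : LogicalError S Nc F) :
    F.Nonempty := by
  rw [Finset.nonempty_iff_ne_empty]
  rintro rfl
  apply hL
  have hX : dataX S Nc (∅ : Finset (Fault ℓ m)) = 0 := by rw [dataX_eq_sum, Finset.sum_empty]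
  have hZ : dataZ S Nc (∅ : Finset (Fault ℓ m)) = 0 := by rw [dataZ_eq_sum, Finset.sum_empty]
  rw [hX, hZ]
  exact ⟨Submodule.zero_mem _, Submodule.zero_mem _⟩

omit [NeZero ℓ] [NeZero m] in
/-- `faultCount` is additive over sets of faults in disjoint cycles. -/
theorem faultCount_union_of_cyc (A B : Finset (Fault ℓ m)) (h : ∀ a ∈ A, ∀ b ∈ B, a.cyc ≠ b.cyc) :
    faultCount (A ∪ B) = faultCount A + faultCount B := by
  classical
  unfold faultCount
  rw [Finset.image_union, Finset.card_union_of_disjoint]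
  rw [Finset.disjoint_left]
  intro L hLA hLB
  obtain ⟨a, ha, rfl⟩ := Finset.mem_image.1 hLA
  obtain ⟨b, hb, hab⟩ := Finset.mem_image.1 hLB
  exact h a ha b hb (by rw [Fault.cyc_eq_loc_cyc, Fault.cyc_eq_loc_cyc, hab])

omit [NeZero ℓ] [NeZero m] in
/-- The number of distinct cycles used is at most the number of faulty operations. -/
theorem card_image_cyc_le (F : Finset (Fault ℓ m)) : (F.image Fault.cyc).card ≤ faultCount F := by
  classical
  unfold faultCount
  have : F.image Fault.cyc = (F.image Fault.loc).image Loc.cyc := by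
    rw [Finset.image_image]; exact Finset.image_congr fun f _ => Fault.cyc_eq_loc_cyc f
  rw [this]; exact Finset.card_image_le

/-- **WINDOW LEMMA (T3).** If some `Nc`-cycle circuit has an undetectable logical fault set of `≤ w` faulty operations, so
does the `min Nc w`-cycle circuit. -/
theorem hasAt_window (S : SMCode ℓ m) (Nc w : ℕ) :
    HasLogicalFaultOfWeightAtMostAt S Nc w → HasLogicalFaultOfWeightAtMostAt S (min Nc w) w := by
  classical
  intro h
  rcases Nat.le_total Nc w with hle | hle
  · rw [min_eq_left hle]; exact h
  rw [min_eq_right hle]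
  -- a minimal normal witness
  have hex : ∃ k, ∃ F : Finset (Fault ℓ m), Normal Nc F ∧ Undetectable S Nc F ∧ LogicalError S Nc F ∧ faultCount F = k ∧ k ≤ w := by
    obtain ⟨F, hU, hL, hw⟩ := h
    obtain ⟨F', hN, hU', hL', hc⟩ := exists_normal S Nc F hU hL
    exact ⟨_, F', hN, hU', hL', rfl, hc.trans hw⟩
  obtain ⟨F, hN, hU, hL, hk, hkw⟩ := Nat.find_spec hex
  have hmin : ∀ k < Nat.find hex, ¬ ∃ F : Finset (Fault ℓ m), Normal Nc F ∧ Undetectable S Nc F ∧ LogicalError S Nc F ∧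
      faultCount F = k ∧ k ≤ w := fun k hk => Nat.find_min hex hk
  set k₀ := Nat.find hex with hk₀
  have hne := nonempty_of_logicalError S Nc F hL
  -- the cycles used
  set C := F.image Fault.cyc with hC
  have hCne : C.Nonempty := hne.image _
  set a := C.min' hCne with ha
  set b := C.max' hCne with hb
  have haC : a ∈ C := Finset.min'_mem C hCne
  have hbC : b ∈ C := Finset.max'_mem C hCne
  have hge : ∀ f ∈ F, a ≤ f.cyc := fun f hf => Finset.min'_le C _ (Finset.mem_image_of_mem _ hf)
  have hle' : ∀ f ∈ F, f.cyc ≤ b := fun f hf => Finset.le_max' C _ (Finset.mem_image_of_mem _ hf)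
  have ha1 : 1 ≤ a := by obtain ⟨f, hf, hfa⟩ := Finset.mem_image.1 haC; rw [← hfa]; exact (hN f hf).1
  -- GAP: the cycles form an interval of length ≤ k₀
  have hspan : b + 1 ≤ a + k₀ := by
    by_contra hcon
    have hCcard : C.card ≤ k₀ := hk ▸ card_image_cyc_le F
    have hlt : C.card < (Finset.Icc a b).card := by rw [Nat.card_Icc]; omega
    obtain ⟨s, hsI, hsC⟩ := Finset.exists_mem_notMem_of_card_lt_card hlt
    rw [Finset.mem_Icc] at hsI
    have hsa : a < s := lt_of_le_of_ne hsI.1 (fun h => hsC (h ▸ haC))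
    have hsb : s < b := lt_of_le_of_ne hsI.2 (fun h => hsC (h ▸ hbC))
    have hs : ∀ f ∈ F, f.cyc ≠ s := fun f hf hfs => hsC (hfs ▸ Finset.mem_image_of_mem _ hf)
    obtain ⟨hUA, hUB⟩ := undetectable_split S Nc F hN hU s hs
    set A := F.filter fun f => f.cyc < s
    set B := F.filter fun f => s < f.cyc
    have hF : F = A ∪ B := by
      ext f; simp only [A, B, Finset.mem_union, Finset.mem_filter]
      constructor
      · intro hf; rcases Nat.lt_or_gt_of_ne (hs f hf) with h | h
        · exact Or.inl ⟨hf, h⟩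
        · exact Or.inr ⟨hf, h⟩
      · rintro (⟨hf, -⟩ | ⟨hf, -⟩) <;> exact hf
    have hAB : Disjoint A B := by rw [Finset.disjoint_filter]; intro f _ h1 h2; omega
    have hNA : Normal Nc A := fun f hf => hN f (Finset.mem_filter.1 hf).1
    have hNB : Normal Nc B := fun f hf => hN f (Finset.mem_filter.1 hf).1
    have hAne : A.Nonempty := by
      obtain ⟨f, hf, hfa⟩ := Finset.mem_image.1 haC
      exact ⟨f, Finset.mem_filter.2 ⟨hf, by omega⟩⟩
    have hBne : B.Nonempty := by
      obtain ⟨f, hf, hfb⟩ := Finset.mem_image.1 hbC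
      exact ⟨f, Finset.mem_filter.2 ⟨hf, by omega⟩⟩
    have hcount : faultCount F = faultCount A + faultCount B := by
      rw [hF]; apply faultCount_union_of_cyc
      intro x hx y hy; have := (Finset.mem_filter.1 hx).2; have := (Finset.mem_filter.1 hy).2; omega
    have hposA : 1 ≤ faultCount A := Finset.card_pos.2 (hAne.image _)
    have hposB : 1 ≤ faultCount B := Finset.card_pos.2 (hBne.image _)
    -- one of the halves is logical
    have hdX : dataX S Nc F = dataX S Nc A + dataX S Nc B := by
      rw [dataX_eq_sum, dataX_eq_sum S Nc A, dataX_eq_sum S Nc B, hF, Finset.sum_union hAB]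
    have hdZ : dataZ S Nc F = dataZ S Nc A + dataZ S Nc B := by
      rw [dataZ_eq_sum, dataZ_eq_sum S Nc A, dataZ_eq_sum S Nc B, hF, Finset.sum_union hAB]
    have hLAB : LogicalError S Nc A ∨ LogicalError S Nc B := by
      rw [logicalError_iff, logicalError_iff]
      rcases (logicalError_iff S Nc F).1 hL with hx | hz
      · by_contra hcon; push Not at hcon
        apply hx; rw [hdX]
        exact Submodule.add_mem _ hcon.1.1 hcon.2.1
      · by_contra hcon; push Not at hcon
        apply hz; rw [hdZ]
        exact Submodule.add_mem _ hcon.1.2 hcon.2.2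
    rcases hLAB with hLA | hLB
    · exact hmin (faultCount A) (by omega) ⟨A, hNA, hUA, hLA, rfl, by omega⟩
    · exact hmin (faultCount B) (by omega) ⟨B, hNB, hUB, hLB, rfl, by omega⟩
  -- SHIFT back by a - 1, then TRUNCATE to w cycles
  obtain ⟨hN', hU', hL', hc', hcyc'⟩ := shift_normal S Nc (a - 1) F hN (fun f hf => by have := hge f hf; omega) hU hL
  have hfit : ∀ f' ∈ F.image (shiftBack (a - 1)), f'.cyc ≤ w := by
    intro f' hf'
    obtain ⟨f, hf, rfl⟩ := Finset.mem_image.1 hf'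
    show (f.retag _).cyc ≤ w
    rw [Fault.cyc_retag]; have := hle' f hf; omega
  obtain ⟨hU'', hL''⟩ := transfer_normal S (F.image (shiftBack (a - 1))) hN' hfit hU' hL'
  exact ⟨_, hU'', hL'', hc'.trans (hk ▸ hkw)⟩

/-- crit-1's form of the window statement (`N₀ = w + 1` a fortiori). -/
theorem hasAt_iff_min (S : SMCode ℓ m) (Nc w : ℕ) :
    HasLogicalFaultOfWeightAtMostAt S Nc w ↔ HasLogicalFaultOfWeightAtMostAt S (min Nc (w + 1)) w := by
  constructor
  · intro h
    rcases Nat.le_total Nc (w + 1) with hle | hle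
    · rw [min_eq_left hle]; exact h
    · rw [min_eq_right hle]
      have h' := hasAt_window S Nc w h
      rw [min_eq_right (by omega)] at h'
      exact hasAt_mono_cycles S (Nat.le_succ w) w h'
  · intro h; exact hasAt_mono_cycles S (Nat.min_le_left Nc (w + 1)) w h

/-- The `∃ Nc` predicate of the pre-registered questions is decided by the single circuit size `N₀ = w`. -/
theorem hasLogicalFault_iff_at (S : SMCode ℓ m) (w : ℕ) :
    HasLogicalFaultOfWeightAtMost S w ↔ HasLogicalFaultOfWeightAtMostAt S w w := by
  constructor
  · rintro ⟨Nc, h⟩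
    have h' := hasAt_window S Nc w h
    exact hasAt_mono_cycles S (Nat.min_le_right Nc w) w h'
  · intro h; exact ⟨w, h⟩

/-- A refutation at `N₀ = w` refutes every circuit size. -/
theorem not_hasAt_of_not_hasAt_self (S : SMCode ℓ m) (w : ℕ) (h : ¬ HasLogicalFaultOfWeightAtMostAt S w w) (Nc : ℕ) :
    ¬ HasLogicalFaultOfWeightAtMostAt S Nc w :=
  fun h' => h ((hasLogicalFault_iff_at S w).1 ⟨Nc, h'⟩)

end Summit.Ventures.QEC.CircuitDistance
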